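import Literature.GroupTheory.CombinatorialGroupTheory.QuadraticSystems
import HarnessLib

/-!
# Gluing the faces of a system of polygons, I: finding and normalising the glued edge

Topic `Literature/GroupTheory/CombinatorialGroupTheory`; continues `QuadraticSystems.lean` (systems
of faces `Fs : List (List (ι × Bool))`, their vertex permutation `sysPerm Fs`, and the one-step
gluing `sysPerm_glue_transitive`: replacing the faces `A ++ [y]`, `C ++ [ȳ]` by `A ++ C` keeps a
one-vertex system one-vertex; Zieschang–Vogt–Coldewey, LNM 835, §3.1, 3.1.5–3.1.6).  To ITERATE
the gluing down to a single face one needs, at each stage: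

* `exists_glue_of_sysPerm_transitive` — **while there are at least two (nonempty) faces and the
  vertex permutation is transitive, the first face has an edge glued to ANOTHER face** (otherwise
  the first face is closed under partners and its letters form a union of vertex cycles);
* `sysPerm_eq_glue_normal_form`, `perm_flatten_glue_normal_form` — **normalisation**: the system
  `(A₁ y A₂) ∷ M ⧺ (C₁ ȳ C₂) ∷ N` has the same vertex permutation as, and the same letters as,
  `(A₂ A₁ y) ∷ (C₂ C₁ ȳ) ∷ M ⧺ N` (rotate the two faces so that the glued edge comes last, and
  bring them to the front), the shape consumed by `sysPerm_glue_transitive`;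
* `glue_flatten_perm`, `nodup_glue`, `closed_glue`, `mem_glue_flatten_iff` — the letters after
  gluing are the letters before except `y`, `ȳ`, still pairwise distinct and closed under partners.

The group-theoretic side (Tietze: `⟨… ∣ A y, C ȳ, …⟩ ≅ ⟨… ∣ A C, y, …⟩`) and the iteration are in
`QuadraticSystemsGluingTietze.lean`.  Block [B2-GLUE] of the Reidemeister–Schreier computation of
finite-index subgroups of surface groups (ZVC 4.14.22).  Theorems only.

## References

* H. Zieschang, E. Vogt, H.-D. Coldewey, *Surfaces and Planar Discontinuous Groups*, LNM 835,
  Springer 1980, §3.1 (3.1.1–3.1.6). [ZieschangVogtColdewey1980]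
-/

namespace Literature.GroupTheory.CombinatorialGroupTheory

open List Equiv Equiv.Perm

variable {ι : Type*} [DecidableEq ι]

/-! ### The letters before and after gluing -/

section Letters

variable {A C : List (ι × Bool)} {Gs : List (List (ι × Bool))} {y : ι × Bool}

omit [DecidableEq ι] in
/-- The letters of `(A y) ∷ (C ȳ) ∷ Gs` are `y`, `ȳ` and the letters of `(A C) ∷ Gs`, up to order.
[cite: ZieschangVogtColdewey1980, 3.1.6] -/
theorem glue_flatten_perm (A C : List (ι × Bool)) (Gs : List (List (ι × Bool))) (y : ι × Bool) :
    (((A ++ [y]) :: (C ++ [bar y]) :: Gs).flatten) ~ y :: bar y :: ((A ++ C) :: Gs).flatten := by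
  simp only [flatten_cons, append_assoc, cons_append, nil_append]
  -- `A ++ y :: (C ++ ȳ :: G) ~ y :: ȳ :: (A ++ (C ++ G))`
  refine perm_middle.trans (Perm.cons _ ?_)
  have e : A ++ (C ++ bar y :: Gs.flatten) = (A ++ C) ++ bar y :: Gs.flatten := by rw [append_assoc]
  rw [e]
  exact perm_middle.trans (by rw [append_assoc])

omit [DecidableEq ι] in
/-- **Gluing keeps the letters distinct.** [cite: ZieschangVogtColdewey1980, 3.1.6] -/
theorem nodup_glue (hd : ((A ++ [y]) :: (C ++ [bar y]) :: Gs).flatten.Nodup) :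
    ((A ++ C) :: Gs).flatten.Nodup :=
  (nodup_cons.1 (nodup_cons.1 ((glue_flatten_perm A C Gs y).nodup_iff.1 hd)).2).2

omit [DecidableEq ι] in
/-- After gluing along `y`, the letter `y` is gone. [cite: ZieschangVogtColdewey1980, 3.1.6] -/
theorem not_mem_glue (hd : ((A ++ [y]) :: (C ++ [bar y]) :: Gs).flatten.Nodup) :
    y ∉ ((A ++ C) :: Gs).flatten :=
  fun h => (nodup_cons.1 ((glue_flatten_perm A C Gs y).nodup_iff.1 hd)).1 (mem_cons_of_mem _ h)

omit [DecidableEq ι] in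
/-- After gluing along `y`, the letter `ȳ` is gone. [cite: ZieschangVogtColdewey1980, 3.1.6] -/
theorem bar_not_mem_glue (hd : ((A ++ [y]) :: (C ++ [bar y]) :: Gs).flatten.Nodup) :
    bar y ∉ ((A ++ C) :: Gs).flatten :=
  fun h => (nodup_cons.1 (nodup_cons.1 ((glue_flatten_perm A C Gs y).nodup_iff.1 hd)).2).1 h

omit [DecidableEq ι] in
/-- **The letters after gluing along `y`** are the letters before, except those with the symbol of
`y`. [cite: ZieschangVogtColdewey1980, 3.1.6] -/
theorem mem_glue_flatten_iff (hd : ((A ++ [y]) :: (C ++ [bar y]) :: Gs).flatten.Nodup) {x : ι × Bool} :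
    x ∈ ((A ++ C) :: Gs).flatten ↔ x ∈ ((A ++ [y]) :: (C ++ [bar y]) :: Gs).flatten ∧ x.1 ≠ y.1 := by
  constructor
  · intro hx
    refine ⟨(glue_flatten_perm A C Gs y).mem_iff.2 (mem_cons_of_mem _ (mem_cons_of_mem _ hx)), fun hxy => ?_⟩
    obtain ⟨i, b⟩ := x
    obtain ⟨j, c⟩ := y
    simp only at hxy
    subst hxy
    rcases Bool.eq_false_or_eq_true b with rfl | rfl <;> rcases Bool.eq_false_or_eq_true c with rfl | rfl
    · exact not_mem_glue hd hx
    · exact bar_not_mem_glue hd hx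
    · exact bar_not_mem_glue hd hx
    · exact not_mem_glue hd hx
  · rintro ⟨hx, hxy⟩
    rcases mem_cons.1 ((glue_flatten_perm A C Gs y).mem_iff.1 hx) with rfl | hx
    · exact absurd rfl hxy
    rcases mem_cons.1 hx with rfl | hx
    · exact absurd rfl hxy
    exact hx

omit [DecidableEq ι] in
/-- **Gluing keeps the system closed under partners.** [cite: ZieschangVogtColdewey1980, 3.1.6] -/
theorem closed_glue (hd : ((A ++ [y]) :: (C ++ [bar y]) :: Gs).flatten.Nodup)
    (hc : Closed ((A ++ [y]) :: (C ++ [bar y]) :: Gs).flatten) : Closed ((A ++ C) :: Gs).flatten := by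
  intro x hx
  rw [mem_glue_flatten_iff hd] at hx ⊢
  exact ⟨hc x hx.1, hx.2⟩

omit [DecidableEq ι] in
/-- The symbol of the glued edge did occur: `(y.1, true)` is a letter of the system before gluing.
[cite: ZieschangVogtColdewey1980, 3.1.6] -/
theorem mem_glue_src_true (y : ι × Bool) (A C : List (ι × Bool)) (Gs : List (List (ι × Bool))) :
    (y.1, true) ∈ ((A ++ [y]) :: (C ++ [bar y]) :: Gs).flatten := by
  refine (glue_flatten_perm A C Gs y).mem_iff.2 ?_
  obtain ⟨i, _ | _⟩ := y
  · exact mem_cons_of_mem _ (by simp [bar])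
  · exact mem_cons_self

end Letters

/-! ### Finding an edge to glue along -/

/-- **While there are two nonempty faces, some edge of the first face is glued to another face** —
provided the vertex permutation of the system is transitive on its letters (the complex is
connected through vertices and edges): otherwise the first face would be closed under partners,
hence its letters a union of vertex cycles of their own. [cite: ZieschangVogtColdewey1980, 3.1.6] -/
theorem exists_glue_of_sysPerm_transitive [Fintype ι] {Φ : List (ι × Bool)} {rest : List (List (ι × Bool))}
    (hd : (Φ :: rest).flatten.Nodup) (hc : Closed (Φ :: rest).flatten) (hΦ : Φ ≠ [])
    (hrest : ∃ F ∈ rest, F ≠ [])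
    (ht : ∀ x ∈ (Φ :: rest).flatten, ∀ z ∈ (Φ :: rest).flatten, (sysPerm (Φ :: rest)).SameCycle x z) :
    ∃ (y : ι × Bool) (A₁ A₂ C₁ C₂ : List (ι × Bool)) (M N : List (List (ι × Bool))),
      Φ = A₁ ++ y :: A₂ ∧ rest = M ++ (C₁ ++ bar y :: C₂) :: N := by
  -- some letter of `Φ` has its partner outside `Φ`
  have hex : ∃ x ∈ Φ, bar x ∉ Φ := by
    by_contra hall
    push Not at hall
    obtain ⟨F, hF, hFne⟩ := hrest
    obtain ⟨z, hz⟩ := exists_mem_of_ne_nil F hFne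
    obtain ⟨x, hx⟩ := exists_mem_of_ne_nil Φ hΦ
    have hΦmem : Φ ∈ Φ :: rest := mem_cons_self
    have hstab : ∀ w ∈ ({w | w ∈ Φ} : Set (ι × Bool)), sysPerm (Φ :: rest) w ∈ ({w | w ∈ Φ} : Set (ι × Bool)) :=
      fun w hw => by
        rw [Set.mem_setOf_eq, sysPerm_apply_of_bar_mem hd hΦmem (hall w hw)]
        exact formPerm_apply_mem_of_mem (hall w hw)
    have hzΦ : z ∈ Φ := SameCycle.mem_of_forall_apply_mem hstab hx
      (ht x (mem_flatten.2 ⟨Φ, hΦmem, hx⟩) z (mem_flatten.2 ⟨F, mem_cons_of_mem _ hF, hz⟩))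
    rw [flatten_cons] at hd
    exact disjoint_of_nodup_append hd hzΦ (mem_flatten.2 ⟨F, hF, hz⟩)
  obtain ⟨y, hyΦ, hy'⟩ := hex
  -- the partner lies in another face
  have hy'mem : bar y ∈ (Φ :: rest).flatten := hc y (mem_flatten.2 ⟨Φ, mem_cons_self, hyΦ⟩)
  rw [flatten_cons, mem_append] at hy'mem
  obtain ⟨Ψ, hΨ, hyΨ⟩ := mem_flatten.1 (hy'mem.resolve_left hy')
  obtain ⟨A₁, A₂, hA⟩ := append_of_mem hyΦ
  obtain ⟨C₁, C₂, hC⟩ := append_of_mem hyΨ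
  obtain ⟨M, N, hMN⟩ := append_of_mem hΨ
  exact ⟨y, A₁, A₂, C₁, C₂, M, N, hA, by rw [hMN, hC]⟩

/-! ### Normalising the two faces to be glued -/

section Normalise

variable (A₁ A₂ C₁ C₂ : List (ι × Bool)) (M N : List (List (ι × Bool))) (y : ι × Bool)

omit [DecidableEq ι] in
/-- `A₁ y A₂` read cyclically from after `y` is `A₂ A₁ y`. [cite: ZieschangVogtColdewey1980, 3.1.1] -/
theorem isRotated_to_last (x : ι × Bool) : (A₁ ++ x :: A₂) ~r ((A₂ ++ A₁) ++ [x]) := by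
  have h1 : (A₁ ++ x :: A₂) ~r ((x :: A₂) ++ A₁) := isRotated_append
  have h2 : ((x :: A₂) ++ A₁) ~r ((A₂ ++ A₁) ++ [x]) := by
    have : (x :: A₂) ++ A₁ = [x] ++ (A₂ ++ A₁) := by simp
    rw [this]; exact isRotated_append
  exact h1.trans h2

omit [DecidableEq ι] in
/-- As lists of faces, `Φ ∷ M ⧺ Ψ ∷ N` is a permutation of `Φ ∷ Ψ ∷ M ⧺ N`. [folklore] -/
private theorem perm_faces_to_front (Φ Ψ : List (ι × Bool)) : (Φ :: (M ++ Ψ :: N)) ~ (Φ :: Ψ :: (M ++ N)) :=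
  Perm.cons Φ perm_middle

omit [DecidableEq ι] in
/-- **The letters of the normalised system** `(A₂ A₁ y) ∷ (C₂ C₁ ȳ) ∷ M ⧺ N` are a permutation of those
of `(A₁ y A₂) ∷ M ⧺ (C₁ ȳ C₂) ∷ N`. [cite: ZieschangVogtColdewey1980, 3.1.6] -/
theorem perm_flatten_glue_normal_form :
    ((A₁ ++ y :: A₂) :: (M ++ (C₁ ++ bar y :: C₂) :: N)).flatten ~
      (((A₂ ++ A₁) ++ [y]) :: ((C₂ ++ C₁) ++ [bar y]) :: (M ++ N)).flatten := by
  refine ((perm_faces_to_front M N _ _).flatten).trans ?_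
  simp only [flatten_cons]
  exact Perm.append (isRotated_to_last A₁ A₂ y).perm
    (Perm.append (isRotated_to_last C₁ C₂ (bar y)).perm (Perm.refl _))

/-- **The vertex permutation of the normalised system** `(A₂ A₁ y) ∷ (C₂ C₁ ȳ) ∷ M ⧺ N` is that of
`(A₁ y A₂) ∷ M ⧺ (C₁ ȳ C₂) ∷ N` (face order and rotations of faces do not matter).
[cite: ZieschangVogtColdewey1980, 3.1.6] -/
theorem sysPerm_eq_glue_normal_form
    (hd : ((A₁ ++ y :: A₂) :: (M ++ (C₁ ++ bar y :: C₂) :: N)).flatten.Nodup) :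
    sysPerm ((A₁ ++ y :: A₂) :: (M ++ (C₁ ++ bar y :: C₂) :: N)) =
      sysPerm (((A₂ ++ A₁) ++ [y]) :: ((C₂ ++ C₁) ++ [bar y]) :: (M ++ N)) := by
  have hnd := (nodup_flatten.1 hd).1
  have hΦ : (A₁ ++ y :: A₂).Nodup := hnd _ mem_cons_self
  have hΨ : (C₁ ++ bar y :: C₂).Nodup := hnd _ (mem_cons_of_mem _ (mem_append_right _ mem_cons_self))
  -- bring `Ψ` to the front, rotate both faces
  have hd1 : ((A₁ ++ y :: A₂) :: (C₁ ++ bar y :: C₂) :: (M ++ N)).flatten.Nodup :=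
    hd.perm (perm_faces_to_front M N _ _).flatten
  rw [sysPerm_eq_of_perm hd (perm_faces_to_front M N _ _),
    sysPerm_cons_eq_of_isRotated _ hΦ (isRotated_to_last A₁ A₂ y)]
  -- rotate the second face: swap it to the front and back
  have hd2 : ((C₁ ++ bar y :: C₂) :: ((A₂ ++ A₁) ++ [y]) :: (M ++ N)).flatten.Nodup := by
    refine hd1.perm ?_
    exact ((Perm.swap _ _ _).trans (Perm.cons _ (Perm.cons _ (Perm.refl _)))).flatten.trans
      (Perm.append (Perm.refl _) (Perm.append (isRotated_to_last A₁ A₂ y).perm (Perm.refl _)))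
  have hd3 : (((A₂ ++ A₁) ++ [y]) :: (C₁ ++ bar y :: C₂) :: (M ++ N)).flatten.Nodup :=
    hd2.perm (Perm.swap _ _ _).flatten
  rw [sysPerm_eq_of_perm hd3 (Perm.swap _ _ _), sysPerm_cons_eq_of_isRotated _ hΨ (isRotated_to_last C₁ C₂ (bar y)),
    sysPerm_eq_of_perm _ (Perm.swap _ _ _)]
  exact hd2.perm (by
    simp only [flatten_cons]
    exact Perm.append (isRotated_to_last C₁ C₂ (bar y)).perm (Perm.refl _))

end Normalise

end Literature.GroupTheory.CombinatorialGroupTheory
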